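import Mathlib
import HarnessLib
import Summits.AtomisticToContinuum.FouriersLaw.Theorems.JunctionLocalityConductanceLowerBoundStubShortTimeDipoleFloorAux5
import Summits.AtomisticToContinuum.FouriersLaw.Theorems.JunctionLocalityConductanceLowerBoundStubShortTimeDipoleFloorAux6

/-!
# Short-time dipole floor, helper 7: the pathwise local light cone (lattice Gronwall series ∘ local Volterra inequality)

Helper (`--supports stmt-AtomisticToContinuum-11749`) for stub `stub_shortTimeDipoleFloor` (S) of line
`kick-dipole-no-collapse`, crux `JunctionLocality.ConductanceLowerBound`.  Deterministic.

`lightCone_pathwise` / `helper_kdLightConePathwise`: for the two flows of the pinned chain from `x` and from `x^{i₀}` driven by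
the same continuous noise path, the site deviation at `k` and time `t' ∈ [0,t]` is bounded by
`2|p_{i₀}| Σ_{n ≥ d(k,i₀)} (t'^n/n!) 3^n S_n`, `S_n = Σ_{d(l,i₀) ≤ n} (C₁ Θ_l)^n` — the light-cone series with LOCAL sums of the
time-independent local weights `Θ_l` of `volterra_local` (helper 6) fed into the lattice Gronwall series (helper 5);
`summable_lightConeSeries` (the series converges pathwise) and `lightCone_pathwise_zero` (the contact site `i₀ = 0`).
-/

noncomputable section

open MeasureTheory Set Filter Topology Finset

namespace Summit.AtomisticToContinuum.FouriersLaw.Cruxes.ConductanceLowerBound.KickDipoleNoCollapse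

open Literature.MathematicalPhysics.KineticTheory.HeatConduction
open Summit.AtomisticToContinuum.FouriersLaw.Theorems.NonBallistic
open Summit.AtomisticToContinuum.FouriersLaw.Theorems.NonBallistic.LightConePropagation

variable {N : ℕ} {ω₂ lam β γ : ℝ}

/-- **Summability of the light-cone series with local sums.**  For nonnegative weights `Θ`, `C₁ ≥ 0`, `t' ≥ 0`, any
distance function `dl` and threshold `D`, `n ↦ [D ≤ n] (t'^n/n!) 3^n Σ_l [dl l ≤ n] (C₁ Θ_l)^n` is summable (dominated by
`N · (3 C₁ (max_l Θ_l) t')^n / n!`). -/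
theorem summable_lightConeSeries {N : ℕ} (i₀ : Fin N) (Θ : Fin N → ℝ) (hΘ0 : ∀ l, 0 ≤ Θ l) {C₁ : ℝ} (hC₁0 : 0 ≤ C₁)
    {t' : ℝ} (ht'0 : 0 ≤ t') (dl : Fin N → ℕ) (D : ℕ) :
    Summable fun n : ℕ => if D ≤ n then t' ^ n / n.factorial * 3 ^ n *
      ∑ l : Fin N, (if dl l ≤ n then (C₁ * Θ l) ^ n else 0) else 0 := by
  obtain ⟨M, hM⟩ : ∃ M : ℝ, M = C₁ * univ.sup' ⟨i₀, Finset.mem_univ _⟩ Θ := ⟨_, rfl⟩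
  have hM0 : 0 ≤ M := by rw [hM]; exact mul_nonneg hC₁0 ((hΘ0 i₀).trans (Finset.le_sup' Θ (Finset.mem_univ i₀)))
  refine Summable.of_nonneg_of_le (fun n => ?_) (fun n => ?_) ((Real.summable_pow_div_factorial (3 * M * t')).mul_left (N : ℝ))
  · split_ifs
    · refine mul_nonneg (by positivity) (Finset.sum_nonneg fun l _ => ?_)
      split_ifs <;> [exact pow_nonneg (mul_nonneg hC₁0 (hΘ0 l)) n; exact le_rfl]
    · exact le_rfl
  · have hS : ∑ l : Fin N, (if dl l ≤ n then (C₁ * Θ l) ^ n else 0) ≤ N * M ^ n := by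
      calc ∑ l : Fin N, (if dl l ≤ n then (C₁ * Θ l) ^ n else 0) ≤ ∑ _l : Fin N, M ^ n := by
            refine Finset.sum_le_sum fun l _ => ?_
            have hlM : C₁ * Θ l ≤ M := hM ▸ mul_le_mul_of_nonneg_left (Finset.le_sup' Θ (Finset.mem_univ l)) hC₁0
            split_ifs
            · exact pow_le_pow_left₀ (mul_nonneg hC₁0 (hΘ0 l)) hlM n
            · positivity
        _ = N * M ^ n := by simp
    have h2 : t' ^ n / n.factorial * 3 ^ n * (N * M ^ n) = N * ((3 * M * t') ^ n / n.factorial) := by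
      rw [mul_pow, mul_pow]; ring
    split_ifs
    · calc t' ^ n / n.factorial * 3 ^ n * ∑ l : Fin N, (if dl l ≤ n then (C₁ * Θ l) ^ n else 0)
          ≤ t' ^ n / n.factorial * 3 ^ n * (N * M ^ n) := mul_le_mul_of_nonneg_left hS (by positivity)
        _ = N * ((3 * M * t') ^ n / n.factorial) := h2
    · positivity

section LightCone

variable (hω : 0 < ω₂) (hl : 0 ≤ lam) (hβ : 0 ≤ β) (hγ : 0 ≤ γ) (N : ℕ) (i₀ : Fin N) (x : PhaseSpace N)
  {η : ℝ → Fin N → ℝ} (hη : Continuous η) {t : ℝ} (ht : 0 ≤ t)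
include hω hl hβ hγ hη ht

/-- **The pathwise local light cone.**  In the setting of `volterra_local`, for every site `k` and `t' ∈ [0, t]`:
`u_k(t') ≤ 2|p_{i₀}| Σ_{n ≥ d(k,i₀)} (t'^n/n!) 3^n S_n` with the LOCAL sums `S_n = Σ_{d(l,i₀) ≤ n} (C₁ Θ_l)^n`
(lattice Gronwall series `latticeGronwall_series` with `Λ_n = C₁ max_{d(l,i₀)≤n} Θ_l`, and `Λ_n^n ≤ S_n/C₁^0`). -/
theorem lightCone_pathwise (k : Fin N) {t' : ℝ} (ht' : t' ∈ Set.Icc 0 t) :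
    |((pinnedChain ω₂ lam β γ).chainFlow N (momentumFlip i₀ x) η t').1 k - ((pinnedChain ω₂ lam β γ).chainFlow N x η t').1 k| +
      |((pinnedChain ω₂ lam β γ).chainFlow N (momentumFlip i₀ x) η t').2 k - ((pinnedChain ω₂ lam β γ).chainFlow N x η t').2 k| ≤
    2 * |x.2 i₀| * ∑' n : ℕ, if (k.val - i₀.val) + (i₀.val - k.val) ≤ n then
      t' ^ n / n.factorial * 3 ^ n * ∑ l : Fin N, (if (l.val - i₀.val) + (i₀.val - l.val) ≤ n then
        ((1 + 2 * γ + (ω₂ + 2 * lam + 8 * (1 + 2 * β))) *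
          ∑ m : Fin N, if m.val ≤ l.val + 1 ∧ l.val ≤ m.val + 1 then
            (1 + (2 * x.1 m ^ 2 + 2 * t * ∫ r in (0:ℝ)..t, ((pinnedChain ω₂ lam β γ).chainFlow N x η r).2 m ^ 2) +
              (2 * x.1 m ^ 2 + 2 * t * ∫ r in (0:ℝ)..t, ((pinnedChain ω₂ lam β γ).chainFlow N (momentumFlip i₀ x) η r).2 m ^ 2))
            else 0) ^ n else 0)
      else 0 := by
  set P := pinnedChain ω₂ lam β γ with hP
  set z : ℝ → PhaseSpace N := P.chainFlow N x η with hz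
  set z' : ℝ → PhaseSpace N := P.chainFlow N (momentumFlip i₀ x) η with hz'
  set u : Fin N → ℝ → ℝ := fun k s => |(z' s).1 k - (z s).1 k| + |(z' s).2 k - (z s).2 k| with hu
  set θ : Fin N → ℝ := fun l => 1 + (2 * x.1 l ^ 2 + 2 * t * ∫ r in (0:ℝ)..t, (z r).2 l ^ 2) +
    (2 * x.1 l ^ 2 + 2 * t * ∫ r in (0:ℝ)..t, (z' r).2 l ^ 2) with hθ
  set Θ : Fin N → ℝ := fun k => ∑ l : Fin N, if l.val ≤ k.val + 1 ∧ k.val ≤ l.val + 1 then θ l else 0 with hΘ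
  set C₁ : ℝ := 1 + 2 * γ + (ω₂ + 2 * lam + 8 * (1 + 2 * β)) with hC₁
  set d : Fin N → ℕ := fun k => (k.val - i₀.val) + (i₀.val - k.val) with hd
  have hC₁0 : 0 ≤ C₁ := by positivity
  obtain ⟨huc, hinit, hinit₀, hΘ1, hineq⟩ := volterra_local hω hl hβ hγ N i₀ x hη ht
  have hΘ0 : ∀ k, 0 ≤ Θ k := fun k => zero_le_one.trans (hΘ1 k)
  -- the local maxima `Λ_n = C₁ max_{d l ≤ n} Θ_l`
  have hne : ∀ n : ℕ, (univ.filter fun l : Fin N => d l ≤ n).Nonempty := fun n =>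
    ⟨i₀, by simp [hd]⟩
  set F : ℕ → ℝ := fun n => (univ.filter fun l : Fin N => d l ≤ n).sup' (hne n) Θ with hF
  have hFmono : Monotone F := by
    intro n m hnm
    refine Finset.sup'_le _ _ fun l hl => Finset.le_sup' Θ ?_
    simp only [Finset.mem_filter, Finset.mem_univ, true_and] at hl ⊢
    exact hl.trans hnm
  have hFle : ∀ n l, d l ≤ n → Θ l ≤ F n := fun n l hl => Finset.le_sup' Θ (by simp [hl])
  have hF0 : 0 ≤ F 0 := (hΘ0 i₀).trans (hFle 0 i₀ (by simp [hd]))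
  have hFtop : ∀ n, F n ≤ univ.sup' ⟨i₀, Finset.mem_univ _⟩ Θ := fun n =>
    Finset.sup'_le _ _ fun l _ => Finset.le_sup' Θ (Finset.mem_univ l)
  have hFpow : ∀ n, F n ^ n ≤ ∑ l : Fin N, if d l ≤ n then Θ l ^ n else 0 := by
    intro n
    obtain ⟨l, hl, hlF⟩ := Finset.exists_mem_eq_sup' (hne n) Θ
    rw [hF]
    dsimp only
    rw [hlF]
    simp only [Finset.mem_filter, Finset.mem_univ, true_and] at hl
    have := Finset.single_le_sum (f := fun l : Fin N => if d l ≤ n then Θ l ^ n else 0)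
      (fun l _ => by split_ifs <;> [exact pow_nonneg (hΘ0 l) n; exact le_rfl]) (Finset.mem_univ l)
    simpa [hl] using this
  -- the lattice Gronwall series
  have key := latticeGronwall_series i₀ ht u (fun k => C₁ * Θ k) (fun n => C₁ * F n) (C₁ * univ.sup' ⟨i₀, Finset.mem_univ _⟩ Θ)
    (fun k => (huc k).continuousOn) (fun k s _ => add_nonneg (abs_nonneg _) (abs_nonneg _)) hinit
    (fun k => mul_nonneg hC₁0 (hΘ0 k)) (fun n k hk => mul_le_mul_of_nonneg_left (hFle n k hk) hC₁0)
    (fun n m h => mul_le_mul_of_nonneg_left (hFmono h) hC₁0) (mul_nonneg hC₁0 hF0)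
    (fun n => mul_le_mul_of_nonneg_left (hFtop n) hC₁0) hineq k t' ht'
  have hinit₀' : u i₀ 0 = 2 * |x.2 i₀| := hinit₀
  rw [hinit₀'] at key
  refine key.trans (mul_le_mul_of_nonneg_left ?_ (by positivity))
  -- compare the two series termwise
  have ht'0 : 0 ≤ t' := ht'.1
  have hΛtop0 : 0 ≤ C₁ * univ.sup' ⟨i₀, Finset.mem_univ _⟩ Θ := mul_nonneg hC₁0 (hF0.trans (hFtop 0))
  have hterm : ∀ n, (if d k ≤ n then t' ^ n / n.factorial * (3 * (C₁ * F n)) ^ n else 0) ≤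
      (if d k ≤ n then t' ^ n / n.factorial * 3 ^ n * ∑ l : Fin N, (if d l ≤ n then (C₁ * Θ l) ^ n else 0) else 0) := by
    intro n
    split_ifs
    · rw [mul_pow, mul_pow, mul_assoc]
      refine mul_le_mul_of_nonneg_left ?_ (by positivity)
      refine mul_le_mul_of_nonneg_left ?_ (by positivity)
      calc C₁ ^ n * F n ^ n ≤ C₁ ^ n * ∑ l : Fin N, (if d l ≤ n then Θ l ^ n else 0) :=
            mul_le_mul_of_nonneg_left (hFpow n) (by positivity)
        _ = ∑ l : Fin N, (if d l ≤ n then (C₁ * Θ l) ^ n else 0) := by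
            rw [Finset.mul_sum]
            refine Finset.sum_congr rfl fun l _ => ?_
            split_ifs <;> simp [mul_pow]
    · exact le_rfl
  have hsum1 : Summable fun n : ℕ => if d k ≤ n then t' ^ n / n.factorial * (3 * (C₁ * F n)) ^ n else 0 :=
    summable_lightConeTerm (d k) ht'0 (fun n => mul_nonneg hC₁0 (hF0.trans (hFmono (Nat.zero_le n))))
      (fun n => mul_le_mul_of_nonneg_left (hFtop n) hC₁0)
  have hsum2 : Summable fun n : ℕ => if d k ≤ n then t' ^ n / n.factorial * 3 ^ n *
      ∑ l : Fin N, (if d l ≤ n then (C₁ * Θ l) ^ n else 0) else 0 :=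
    summable_lightConeSeries i₀ Θ hΘ0 hC₁0 ht'0 d (d k)
  exact hsum1.tsum_le_tsum hterm hsum2

end LightCone

/-- **The pathwise local light cone from the contact site `i₀ = 0`** (`lightCone_pathwise` with the lattice distances
`d(k, 0) = k`, `d(l, 0) = l` written out). -/
theorem lightCone_pathwise_zero (hω : 0 < ω₂) (hl : 0 ≤ lam) (hβ : 0 ≤ β) (hγ : 0 ≤ γ) {N : ℕ} (hN : 0 < N)
    (x : PhaseSpace N) {η : ℝ → Fin N → ℝ} (hη : Continuous η) {t : ℝ} (ht : 0 ≤ t) (k : Fin N) {t' : ℝ}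
    (ht' : t' ∈ Set.Icc 0 t) :
    |((pinnedChain ω₂ lam β γ).chainFlow N (momentumFlip ⟨0, hN⟩ x) η t').1 k - ((pinnedChain ω₂ lam β γ).chainFlow N x η t').1 k| +
      |((pinnedChain ω₂ lam β γ).chainFlow N (momentumFlip ⟨0, hN⟩ x) η t').2 k - ((pinnedChain ω₂ lam β γ).chainFlow N x η t').2 k| ≤
    2 * |x.2 ⟨0, hN⟩| * ∑' n : ℕ, if k.val ≤ n then
      t' ^ n / n.factorial * 3 ^ n * ∑ l : Fin N, (if l.val ≤ n then
        ((1 + 2 * γ + (ω₂ + 2 * lam + 8 * (1 + 2 * β))) *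
          ∑ m : Fin N, if m.val ≤ l.val + 1 ∧ l.val ≤ m.val + 1 then
            (1 + (2 * x.1 m ^ 2 + 2 * t * ∫ r in (0:ℝ)..t, ((pinnedChain ω₂ lam β γ).chainFlow N x η r).2 m ^ 2) +
              (2 * x.1 m ^ 2 + 2 * t * ∫ r in (0:ℝ)..t, ((pinnedChain ω₂ lam β γ).chainFlow N (momentumFlip ⟨0, hN⟩ x) η r).2 m ^ 2))
            else 0) ^ n else 0)
      else 0 := by
  have e1 : ∀ m : Fin N, (m.val - (⟨0, hN⟩ : Fin N).val) + ((⟨0, hN⟩ : Fin N).val - m.val) = m.val := fun m => by simp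
  have h := lightCone_pathwise hω hl hβ hγ N ⟨0, hN⟩ x hη ht k ht'
  simp only [e1] at h
  exact h

/-- **Registered helper `helper_kdLightConePathwise` (stub S, line `kick-dipole-no-collapse`): THE PATHWISE LOCAL LIGHT CONE**
(closed form of `lightCone_pathwise`). -/
theorem helper_kdLightConePathwise : ∀ ω₂ lam β γ : ℝ, 0 < ω₂ → 0 ≤ lam → 0 ≤ β → 0 ≤ γ → ∀ (N : ℕ) (i₀ : Fin N) (x : PhaseSpace N) (η : ℝ → Fin N → ℝ), Continuous η → ∀ (t : ℝ), 0 ≤ t → ∀ (k : Fin N) (t' : ℝ), t' ∈ Set.Icc 0 t → |((pinnedChain ω₂ lam β γ).chainFlow N (momentumFlip i₀ x) η t').1 k - ((pinnedChain ω₂ lam β γ).chainFlow N x η t').1 k| + |((pinnedChain ω₂ lam β γ).chainFlow N (momentumFlip i₀ x) η t').2 k - ((pinnedChain ω₂ lam β γ).chainFlow N x η t').2 k| ≤ 2 * |x.2 i₀| * ∑' n : ℕ, if (k.val - i₀.val) + (i₀.val - k.val) ≤ n then t' ^ n / n.factorial * 3 ^ n * ∑ l : Fin N, (if (l.val - i₀.val)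 + (i₀.val - l.val) ≤ n then ((1 + 2 * γ + (ω₂ + 2 * lam + 8 * (1 + 2 * β))) * ∑ m : Fin N, if m.val ≤ l.val + 1 ∧ l.val ≤ m.val + 1 then (1 + (2 * x.1 m ^ 2 + 2 * t * ∫ r in (0:ℝ)..t, ((pinnedChain ω₂ lam β γ).chainFlow N x η r).2 m ^ 2) + (2 * x.1 m ^ 2 + 2 * t * ∫ r in (0:ℝ)..t, ((pinnedChain ω₂ lam β γ).chainFlow N (momentumFlip i₀ x) η r).2 m ^ 2)) else 0) ^ n else 0) else 0 := by
  intro ω₂ lam β γ hω hl hβ hγ N i₀ x η hη t ht k t' ht'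
  exact lightCone_pathwise hω hl hβ hγ N i₀ x hη ht k ht'

end Summit.AtomisticToContinuum.FouriersLaw.Cruxes.ConductanceLowerBound.KickDipoleNoCollapse

end
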